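import Summits.ValiantsHypothesis.ValiantsHypothesis.Theorems.DepthWindowTwoLetterRound

/-!
# Route `DepthWindow` — `ULB₂` holds for two-letter words

Cone-free theorem (decomp-valiant lens 4, g15; critic-675 NEXT (b)) supporting the crux item `HomImmHardTwoOne`
(stmt-ValiantsHypothesis-30635) through the tree-bias door (`DepthWindowNodeBias`):

* `lowBiasTree_twoLetter` — **every two-valued word** `w : Fin d → ℤ` with `|wᵢ| ≤ h`, `|Σ wᵢ| ≤ h` has a
  low-bias tree of EVERY depth `Δ ≥ min (2·log₂log₂ h + 8, 2·log₂log₂ d + 9)` with node bias `≤ 6h` everywhere;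
  `universalLowBiasAt_two_twoLetter` is the body of `UniversalLowBiasAt 2` VERBATIM (`B = 6`, `c₁ = 9`) on the
  class of two-letter words.
* `not_twoLetter_treeBiasGrowthAt` — consequently NO family of two-letter words can witness
  `TreeBiasGrowthAt a` for any slope `a ≥ 2`: an adversary certifying the A-cell `HomImmHardAt 2 1` through
  the door `treeBiasDoorAt` must use at least three letter values.

The proof iterates the round of `DepthWindowTwoLetterRound`: after a completed round the exponent pair
`(p, p')` (`ρ_{i+1} 2^p ≤ h`, `ρ_i 2^{p'} ≤ h`) becomes `(p + p' + 1, p)` — Fibonacci growth, `p` at least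
doubles every two rounds — so after `2·log₂log₂ h + O(1)` levels the state is exhausted (`descend`); the first
round from the raw letters (`i = 0`, `p = p' = 0`) yields `p ≥ 1`.  The `d`-form (`descend_d`) runs the same
rounds with the letter count as the potential: the counts are re-expressed exactly, so `A·|τ_i| + B·|τ_{i+1}| = d`
is invariant (`size`, `size_transfer`), and a completed round from a state with `ρ_i 2^{p'} ≤ h` certifies
`|τ_{i+N+3}| > 3·2^{p'}` (`size_growth`: the next type is unaffordable), a block that must exist two rounds later —
so `2^{p'} < d` as long as the descent continues.

References: [LimayeSrinivasanTavenas2022] full version §1.2 Question 1, Prop. 17, Thm. 27;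
[BhargavDuttaSaxena2024] §5 (designed two-letter families); the universal two-letter statement is, as far as
we know, new (workshop record NODE-v15).
-/

-- layout Summits/ValiantsHypothesis/ValiantsHypothesis forces the duplicated namespace component
set_option linter.dupNamespace false

namespace Summit.ValiantsHypothesis.ValiantsHypothesis.Theorems.DepthWindow.TreeBias

open Finset Literature.Computability.AlgebraicComplexity TwoLetter

/-! ### Block sizes of the convergent types -/

namespace TwoLetter

variable (t s : ℕ)

/-- Number of letters in a block of type `τ_n`: `|τ_0| = |τ_1| = 1`, `|τ_{n+2}| = a_n·|τ_{n+1}| + |τ_n|`. [folklore] -/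
def size : ℕ → ℕ
  | 0 => 1
  | 1 => 1
  | n + 2 => quo t s n * size (n + 1) + size n

/-- `|τ_0| = 1`. [folklore] -/
@[simp] theorem size_zero : size t s 0 = 1 := rfl

/-- `|τ_1| = 1`. [folklore] -/
@[simp] theorem size_one : size t s 1 = 1 := rfl

/-- The recurrence of `size`. [folklore] -/
theorem size_add_two (n : ℕ) : size t s (n + 2) = quo t s n * size t s (n + 1) + size t s n := rfl

/-- `1 ≤ |τ_n|`. [folklore] -/
theorem one_le_size : ∀ n, 1 ≤ size t s n
  | 0 => le_rfl
  | 1 => le_rfl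
  | n + 2 => by rw [size_add_two]; have := one_le_size n; omega

/-- Sizes in the basis `(τ_i, τ_{i+1})`: `|τ_{i+n}| = cfL n·|τ_i| + cfR n·|τ_{i+1}|`. [folklore] -/
theorem size_base (i : ℕ) : ∀ n, size t s (i + n) = cfL t s i n * size t s i + cfR t s i n * size t s (i + 1)
  | 0 => by simp
  | 1 => by simp
  | n + 2 => by
    rw [show i + (n + 2) = (i + n) + 2 by omega, size_add_two, show i + n + 1 = i + (n + 1) by omega,
      size_base i (n + 1), size_base i n, cfL_add_two, cfR_add_two]
    ring

/-- `size` is monotone along a stretch of partial quotients `≥ 1`. [folklore] -/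
theorem size_mono (j : ℕ) : ∀ n, (∀ m, j ≤ m + 1 → m + 2 ≤ j + n → 1 ≤ quo t s m) → size t s j ≤ size t s (j + n)
  | 0, _ => le_rfl
  | n + 1, hq => by
    have ih := size_mono j n fun m h1 h2 => hq m h1 (by omega)
    refine ih.trans ?_
    rcases Nat.eq_zero_or_pos (j + n) with h0 | hjn
    · rw [h0, show j + (n + 1) = 1 by omega, size_zero, size_one]
    · obtain ⟨m, hm⟩ : ∃ m, j + n = m + 1 := ⟨j + n - 1, by omega⟩
      rw [hm, show j + (n + 1) = m + 2 by omega, size_add_two]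
      have h1 := Nat.mul_le_mul_right (size t s (m + 1)) (hq m (by omega) (by omega))
      rw [one_mul] at h1
      omega

/-- **Count bookkeeping is exact**: re-expressing `A·τ_i + B·τ_{i+1}` as `A₁·τ_{i+N+1} + B₁·τ_{i+N+2}` preserves
the number of letters. [folklore] -/
theorem size_transfer (i N A B A₁ B₁ : ℕ) (hA : A = A₁ * cfL t s i (N + 1) + B₁ * cfL t s i (N + 2))
    (hB : B = A₁ * cfR t s i (N + 1) + B₁ * cfR t s i (N + 2)) :
    A₁ * size t s (i + (N + 1)) + B₁ * size t s (i + (N + 1) + 1) = A * size t s i + B * size t s (i + 1) := by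
  rw [show i + (N + 1) + 1 = i + (N + 2) by omega, size_base t s i (N + 1), size_base t s i (N + 2), hA, hB]
  ring

/-- **Growth certificate of a completed round**: if `τ_{i+N+3}` is unaffordable (`6h < cost`) from a state with
`ρ_i·2^{p'} ≤ h`, then `|τ_{i+N+3}| > 3·2^{p'}`. [folklore] -/
theorem size_growth {i N p' h : ℕ} (hi1 : 0 < rho t s (i + 1))
    (hdec : rho t s (i + 1) ≤ rho t s i) (hp' : rho t s i * 2 ^ p' ≤ h) (hcost : 6 * h < cost t s i (N + 3)) :
    3 * 2 ^ p' < size t s (i + (N + 3)) := by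
  have ha : 1 ≤ quo t s i := one_le_quo t s i hi1 hdec
  have hLR := cfL_le_cfR t s i ha (N + 3) (by omega)
  unfold cost at hcost
  have e1 := Nat.mul_le_mul_right (rho t s i) hLR
  have e2 := Nat.mul_le_mul_left (cfR t s i (N + 3)) hdec
  have h2 : (3 * 2 ^ p') * rho t s i < cfR t s i (N + 3) * rho t s i :=
    calc (3 * 2 ^ p') * rho t s i = 3 * (rho t s i * 2 ^ p') := by ring
      _ ≤ 3 * h := Nat.mul_le_mul_left 3 hp'
      _ < cfR t s i (N + 3) * rho t s i := by omega
  have h3 : 3 * 2 ^ p' < cfR t s i (N + 3) := Nat.lt_of_mul_lt_mul_right h2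
  rw [size_base]
  calc 3 * 2 ^ p' < cfR t s i (N + 3) := h3
    _ ≤ cfR t s i (N + 3) * size t s (i + 1) := Nat.le_mul_of_pos_right _ (one_le_size t s (i + 1))
    _ ≤ _ := Nat.le_add_left _ _

end TwoLetter

section Builder

variable {t s h : ℕ}

/-- **The descent.**  From an admissible state with exponent `p ≥ 1` and `h < 2^(p·2^F)`, every depth
`≥ 2F + 3` admits a low-bias tree: two rounds at least double `p`. [folklore] -/
theorem descend (hs1 : 1 ≤ s) (hst : s ≤ t) (hth : t ≤ h) : ∀ (F i A B p p' : ℕ),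
    (∀ m ≤ i + 1, 0 < rho t s m) → rho t s (i + 1) ≤ rho t s i →
    |(A : ℤ) * ev t s i + (B : ℤ) * ev t s (i + 1)| ≤ h → rho t s (i + 1) * 2 ^ p ≤ h → rho t s i * 2 ^ p' ≤ h →
    1 ≤ p → h < 2 ^ (p * 2 ^ F) →
    ∀ Δ, 2 * F + 3 ≤ Δ → LowBiasTree (twoWord A B (ev t s i) (ev t s (i + 1))) Δ ((6 * h : ℕ) : ℤ)
  | 0, i, A, B, p, p', hpos, _hdec, _hbal, hp, _hp', _hp1, hF, Δ, _hΔ => by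
    exfalso
    have h1 : 1 ≤ rho t s (i + 1) := hpos (i + 1) le_rfl
    have h2 : 2 ^ p ≤ h := le_trans (by simpa using Nat.mul_le_mul_right (2 ^ p) h1) hp
    simp only [pow_zero, mul_one] at hF
    omega
  | F + 1, i, A, B, p, p', hpos, hdec, hbal, hp, hp', hp1, hF, Δ, hΔ => by
    obtain ⟨A₁, B₁, X₁, Y₁, hlift₁, hfin₁ | ⟨i₁, rfl, rfl, _hA₁, _hB₁, hpos₁, hdec₁, hbal₁, hq₁, hq₁', -⟩⟩ :=
      round_step hs1 hst hth hpos hdec hbal hp hp'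
    · obtain ⟨Δ', rfl⟩ : ∃ Δ', Δ = Δ' + 1 := ⟨Δ - 1, by omega⟩
      exact hlift₁ Δ' (hfin₁ Δ' (by omega))
    · obtain ⟨A₂, B₂, X₂, Y₂, hlift₂, hfin₂ | ⟨i₂, rfl, rfl, _hA₂, _hB₂, hpos₂, hdec₂, hbal₂, hq₂, hq₂', -⟩⟩ :=
        round_step hs1 hst hth hpos₁ hdec₁ hbal₁ hq₁ hq₁'
      · obtain ⟨Δ', rfl⟩ : ∃ Δ', Δ = Δ' + 1 + 1 := ⟨Δ - 2, by omega⟩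
        exact hlift₁ _ (hlift₂ Δ' (hfin₂ Δ' (by omega)))
      · have hF' : h < 2 ^ ((p + p' + 1 + p + 1) * 2 ^ F) := by
          refine lt_of_lt_of_le hF (Nat.pow_le_pow_right two_pos ?_)
          calc p * 2 ^ (F + 1) = (p + p) * 2 ^ F := by rw [pow_succ]; ring
            _ ≤ (p + p' + 1 + p + 1) * 2 ^ F := Nat.mul_le_mul_right _ (by omega)
        obtain ⟨Δ', rfl⟩ : ∃ Δ', Δ = Δ' + 1 + 1 := ⟨Δ - 2, by omega⟩
        exact hlift₁ _ (hlift₂ Δ' (descend hs1 hst hth F i₂ A₂ B₂ (p + p' + 1 + p + 1) (p + p' + 1) hpos₂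
          hdec₂ hbal₂ hq₂ hq₂' (by omega) hF' Δ' (by omega)))

/-- **Two rounds with the letter count.**  From an admissible state whose blocks use at most `d₀` letters:
either the word is finished within two levels (every depth `≥ 3` works), or two levels lead to an admissible
state with exponents `(2p + p' + 2, p + p' + 1)`, at most `d₀` letters, and the certificate `3·2^{p'} < d₀`.
[folklore] -/
theorem two_rounds (hs1 : 1 ≤ s) (hst : s ≤ t) (hth : t ≤ h) {d₀ i A B p p' : ℕ}
    (hpos : ∀ m ≤ i + 1, 0 < rho t s m) (hdec : rho t s (i + 1) ≤ rho t s i)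
    (hbal : |(A : ℤ) * ev t s i + (B : ℤ) * ev t s (i + 1)| ≤ h)
    (hp : rho t s (i + 1) * 2 ^ p ≤ h) (hp' : rho t s i * 2 ^ p' ≤ h)
    (hd : A * size t s i + B * size t s (i + 1) ≤ d₀) :
    (∀ Δ, 3 ≤ Δ → LowBiasTree (twoWord A B (ev t s i) (ev t s (i + 1))) Δ ((6 * h : ℕ) : ℤ)) ∨
    ∃ i₂ A₂ B₂ : ℕ,
      (∀ Δ, LowBiasTree (twoWord A₂ B₂ (ev t s i₂) (ev t s (i₂ + 1))) Δ ((6 * h : ℕ) : ℤ) →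
          LowBiasTree (twoWord A B (ev t s i) (ev t s (i + 1))) (Δ + 1 + 1) ((6 * h : ℕ) : ℤ)) ∧
      (∀ m ≤ i₂ + 1, 0 < rho t s m) ∧ rho t s (i₂ + 1) ≤ rho t s i₂ ∧
      |(A₂ : ℤ) * ev t s i₂ + (B₂ : ℤ) * ev t s (i₂ + 1)| ≤ h ∧
      rho t s (i₂ + 1) * 2 ^ (p + p' + 1 + p + 1) ≤ h ∧ rho t s i₂ * 2 ^ (p + p' + 1) ≤ h ∧
      A₂ * size t s i₂ + B₂ * size t s (i₂ + 1) ≤ d₀ ∧ 3 * 2 ^ p' < d₀ := by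
  obtain ⟨A₁, B₁, X₁, Y₁, hlift₁, hfin₁ |
      ⟨i₁, rfl, rfl, _hA₁, _hB₁, hpos₁, hdec₁, hbal₁, hq₁, hq₁', N₁, hi₁, hcA₁, hcB₁, hcost₁⟩⟩ :=
    round_step hs1 hst hth hpos hdec hbal hp hp'
  · left; intro Δ hΔ
    obtain ⟨Δ', rfl⟩ : ∃ Δ', Δ = Δ' + 1 := ⟨Δ - 1, by omega⟩
    exact hlift₁ Δ' (hfin₁ Δ' (by omega))
  subst hi₁
  have hd₁ : A₁ * size t s (i + (N₁ + 1)) + B₁ * size t s (i + (N₁ + 1) + 1) ≤ d₀ := by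
    rw [size_transfer t s i N₁ A B A₁ B₁ hcA₁ hcB₁]; exact hd
  have hgrow : 3 * 2 ^ p' < size t s (i + (N₁ + 3)) :=
    size_growth t s (hpos (i + 1) le_rfl) hdec hp' hcost₁
  obtain ⟨A₂, B₂, X₂, Y₂, hlift₂, hfin₂ |
      ⟨i₂, rfl, rfl, _hA₂, hB₂, hpos₂, hdec₂, hbal₂, hq₂, hq₂', N₂, hi₂, hcA₂, hcB₂, -⟩⟩ :=
    round_step hs1 hst hth hpos₁ hdec₁ hbal₁ hq₁ hq₁'
  · left; intro Δ hΔ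
    obtain ⟨Δ', rfl⟩ : ∃ Δ', Δ = Δ' + 1 + 1 := ⟨Δ - 2, by omega⟩
    exact hlift₁ _ (hlift₂ Δ' (hfin₂ Δ' (by omega)))
  subst hi₂
  have hd₂ : A₂ * size t s (i + (N₁ + 1) + (N₂ + 1)) + B₂ * size t s (i + (N₁ + 1) + (N₂ + 1) + 1) ≤ d₀ := by
    rw [size_transfer t s (i + (N₁ + 1)) N₂ A₁ B₁ A₂ B₂ hcA₂ hcB₂]; exact hd₁
  have hmono : size t s (i + (N₁ + 3)) ≤ size t s (i + (N₁ + 1) + (N₂ + 1) + 1) := by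
    have := size_mono t s (i + (N₁ + 3)) N₂ fun m h1 _ =>
      one_le_quo t s m (hpos₂ (m + 1) (by omega)) (rho_succ_le t s m (by omega) (hpos₂ m (by omega)))
    rwa [show i + (N₁ + 3) + N₂ = i + (N₁ + 1) + (N₂ + 1) + 1 by omega] at this
  have hsz : size t s (i + (N₁ + 1) + (N₂ + 1) + 1) ≤ d₀ :=
    le_trans (le_trans (Nat.le_mul_of_pos_left _ hB₂) (Nat.le_add_left _ _)) hd₂
  right
  exact ⟨_, A₂, B₂, fun Δ hT => hlift₁ _ (hlift₂ Δ hT), hpos₂, hdec₂, hbal₂, hq₂, hq₂', hd₂, by omega⟩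

/-- **The descent, `d`-form.**  From an admissible state with `p' ≤ p`, at most `d₀` letters and
`d₀ < 2^(p'·2^F)`, every depth `≥ 2F + 3` admits a low-bias tree: two rounds at least double `p'`, and the
descent cannot continue once `2^{p'} ≥ d₀`. [folklore] -/
theorem descend_d (hs1 : 1 ≤ s) (hst : s ≤ t) (hth : t ≤ h) {d₀ : ℕ} (F : ℕ) : ∀ (i A B p p' : ℕ),
    (∀ m ≤ i + 1, 0 < rho t s m) → rho t s (i + 1) ≤ rho t s i →
    |(A : ℤ) * ev t s i + (B : ℤ) * ev t s (i + 1)| ≤ h → rho t s (i + 1) * 2 ^ p ≤ h → rho t s i * 2 ^ p' ≤ h →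
    p' ≤ p → A * size t s i + B * size t s (i + 1) ≤ d₀ → d₀ < 2 ^ (p' * 2 ^ F) →
    ∀ Δ, 2 * F + 3 ≤ Δ → LowBiasTree (twoWord A B (ev t s i) (ev t s (i + 1))) Δ ((6 * h : ℕ) : ℤ) := by
  induction F with
  | zero =>
    intro i A B p p' hpos hdec hbal hp hp' _ hd hF Δ hΔ
    rcases two_rounds hs1 hst hth hpos hdec hbal hp hp' hd with hfin | ⟨i₂, A₂, B₂, -, -, -, -, -, -, -, hlt⟩
    · exact hfin Δ hΔ
    · exfalso
      rw [pow_zero, mul_one] at hF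
      omega
  | succ F ih =>
    intro i A B p p' hpos hdec hbal hp hp' hp'p hd hF Δ hΔ
    rcases two_rounds hs1 hst hth hpos hdec hbal hp hp' hd with
      hfin | ⟨i₂, A₂, B₂, hlift, hpos₂, hdec₂, hbal₂, hq₂, hq₂', hd₂, -⟩
    · exact hfin Δ (by omega)
    · have hF' : d₀ < 2 ^ ((p + p' + 1) * 2 ^ F) := by
        refine lt_of_lt_of_le hF (Nat.pow_le_pow_right two_pos ?_)
        calc p' * 2 ^ (F + 1) = (p' + p') * 2 ^ F := by rw [pow_succ]; ring
          _ ≤ (p + p' + 1) * 2 ^ F := Nat.mul_le_mul_right _ (by omega)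
      obtain ⟨Δ', rfl⟩ : ∃ Δ', Δ = Δ' + 1 + 1 := ⟨Δ - 2, by omega⟩
      exact hlift Δ' (ih i₂ A₂ B₂ (p + p' + 1 + p + 1) (p + p' + 1) hpos₂ hdec₂ hbal₂ hq₂ hq₂' (by omega)
        hd₂ hF' Δ' (by omega))

end Builder

/-- The two-letter theorem in builder coordinates: values `a < 0 < b` with `b ≤ -a ≤ h`. [folklore] -/
theorem lowBiasTree_twoLetter_core {d : ℕ} (w : Fin d → ℤ) (h : ℕ) {a b : ℤ} (ha : a < 0) (hb : 0 < b)
    (hba : b ≤ -a) (hw : ∀ k, w k = a ∨ w k = b) (hah : -a ≤ h) (hsum : |∑ k, w k| ≤ h)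
    {Δ : ℕ} (hΔ : 2 * Nat.log 2 (Nat.log 2 h) + 8 ≤ Δ ∨ 2 * Nat.log 2 (Nat.log 2 d) + 9 ≤ Δ) :
    LowBiasTree w Δ ((6 * h : ℕ) : ℤ) := by
  classical
  obtain ⟨t, ht⟩ : ∃ t : ℕ, (t : ℤ) = -a := ⟨(-a).toNat, Int.toNat_of_nonneg (by omega)⟩
  obtain ⟨s, hs⟩ : ∃ s : ℕ, (s : ℤ) = b := ⟨b.toNat, Int.toNat_of_nonneg hb.le⟩
  have hs1 : 1 ≤ s := by omega
  have hst : s ≤ t := by omega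
  have hth : t ≤ h := by omega
  have hev0 : ev t s 0 = a := by rw [ev_zero]; omega
  have hev1 : ev t s (0 + 1) = b := by rw [Nat.zero_add, ev_one]; exact hs
  apply lowBiasTree_of_twoValued w hw
  set A := (univ.filter fun k => w k = a).card with hAdef
  set B := (univ.filter fun k => ¬ w k = a).card with hBdef
  have hsumw : ∑ k, w k = (A : ℤ) * a + (B : ℤ) * b := by
    rw [← sum_filter_add_sum_filter_not univ (fun k => w k = a)]
    rw [sum_congr rfl (fun k hk => (mem_filter.1 hk).2),
      sum_congr rfl (fun k hk => (hw k).resolve_left (mem_filter.1 hk).2)]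
    simp [sum_const, hAdef, hBdef]
  have hbal : |(A : ℤ) * ev t s 0 + (B : ℤ) * ev t s (0 + 1)| ≤ h := by rw [hev0, hev1, ← hsumw]; exact hsum
  have hpos : ∀ m ≤ 0 + 1, 0 < rho t s m := by
    intro m hm
    interval_cases m
    · rw [rho_zero]; omega
    · rw [rho_one]; omega
  have hdec : rho t s (0 + 1) ≤ rho t s 0 := by simpa using hst
  have hp : rho t s (0 + 1) * 2 ^ 0 ≤ h := by simpa using le_trans hst hth
  have hp' : rho t s 0 * 2 ^ 0 ≤ h := by simpa using hth
  rcases hΔ with hΔ | hΔd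
  swap
  · ------------------------------------------------------------------ the `d`-form
    have hd : A * size t s 0 + B * size t s (0 + 1) ≤ d := by
      simp only [size_zero, Nat.zero_add, size_one, mul_one, hAdef, hBdef]
      rw [card_filter_add_card_filter_not]; simp
    rcases two_rounds hs1 hst hth hpos hdec hbal hp hp' hd with
      hfin | ⟨i₂, A₂, B₂, hlift, hpos₂, hdec₂, hbal₂, hq₂, hq₂', hd₂, -⟩
    · have := hfin Δ (by omega); rwa [hev0, hev1] at this
    · set L := Nat.log 2 d with hLdef
      set F := Nat.log 2 (L + 1) + 1 with hFdef
      have hF : d < 2 ^ ((0 + 0 + 1) * 2 ^ F) := by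
        rw [show 0 + 0 + 1 = 1 from rfl, one_mul]
        have h1 : d < 2 ^ (L + 1) := Nat.lt_pow_succ_log_self one_lt_two d
        have h2 : L + 1 < 2 ^ F := Nat.lt_pow_succ_log_self one_lt_two (L + 1)
        exact lt_of_lt_of_le h1 (Nat.pow_le_pow_right two_pos h2.le)
      have hFle : 2 * F + 5 ≤ Δ := by
        have : Nat.log 2 (L + 1) ≤ Nat.log 2 L + 1 :=
          (le_trans (Nat.log_mono_right (Nat.lt_pow_succ_log_self one_lt_two _)) (Nat.log_pow one_lt_two _).le)
        omega
      obtain ⟨Δ', rfl⟩ : ∃ Δ', Δ = Δ' + 1 + 1 := ⟨Δ - 2, by omega⟩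
      have := hlift Δ' (descend_d hs1 hst hth F i₂ A₂ B₂ (0 + 0 + 1 + 0 + 1) (0 + 0 + 1) hpos₂ hdec₂ hbal₂
        hq₂ hq₂' (by omega) hd₂ hF Δ' (by omega))
      rwa [hev0, hev1] at this
  -------------------------------------------------------------------- the `h`-form
  obtain ⟨A₁, B₁, X₁, Y₁, hlift, hfin | ⟨i₁, rfl, rfl, _hA₁, _hB₁, hpos₁, hdec₁, hbal₁, hq₁, hq₁', -⟩⟩ :=
    round_step (i := 0) (p := 0) (p' := 0) hs1 hst hth hpos hdec hbal hp hp'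
  · obtain ⟨Δ', rfl⟩ : ∃ Δ', Δ = Δ' + 1 := ⟨Δ - 1, by omega⟩
    have := hlift Δ' (hfin Δ' (by omega))
    rwa [hev0, hev1] at this
  · set L := Nat.log 2 h with hLdef
    set F := Nat.log 2 (L + 1) + 1 with hFdef
    have hF : h < 2 ^ ((0 + 0 + 1) * 2 ^ F) := by
      rw [show 0 + 0 + 1 = 1 from rfl, one_mul]
      have h1 : h < 2 ^ (L + 1) := Nat.lt_pow_succ_log_self one_lt_two h
      have h2 : L + 1 < 2 ^ F := Nat.lt_pow_succ_log_self one_lt_two (L + 1)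
      exact lt_of_lt_of_le h1 (Nat.pow_le_pow_right two_pos h2.le)
    have hFle : 2 * F + 4 ≤ Δ := by
      have : Nat.log 2 (L + 1) ≤ Nat.log 2 L + 1 :=
        (le_trans (Nat.log_mono_right (Nat.lt_pow_succ_log_self one_lt_two _)) (Nat.log_pow one_lt_two _).le)
      omega
    obtain ⟨Δ', rfl⟩ : ∃ Δ', Δ = Δ' + 1 := ⟨Δ - 1, by omega⟩
    have := hlift Δ' (descend hs1 hst hth F i₁ A₁ B₁ (0 + 0 + 1) 0 hpos₁ hdec₁ hbal₁ hq₁ hq₁' (by omega) hF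
      Δ' (by omega))
    rwa [hev0, hev1] at this

/-- **`ULB₂` for two-letter words.**  Every two-valued word with `|wᵢ| ≤ h`, `|Σ wᵢ| ≤ h` has, for every depth
`Δ ≥ min (2·log₂log₂ h + 8, 2·log₂log₂ d + 9)`, a depth-`Δ` tree (all leaves at level `0`, one block at level
`Δ`) whose node bias is `≤ 6h` everywhere.  Universal slope `2` with an `O(h)` budget — what
`UniversalLowBiasAt 2` asks — on the class of two-letter words, in both the `h`-form and the `d`-form.
[cite: LimayeSrinivasanTavenas2022, Question 1, Thm. 27] -/
theorem lowBiasTree_twoLetter {d : ℕ} (w : Fin d → ℤ) (h : ℕ) (h2 : ∃ x y : ℤ, ∀ i, w i = x ∨ w i = y)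
    (hw : ∀ i, |w i| ≤ h) (hsum : |∑ i, w i| ≤ h) {Δ : ℕ}
    (hΔ : 2 * Nat.log 2 (Nat.log 2 h) + 8 ≤ Δ ∨ 2 * Nat.log 2 (Nat.log 2 d) + 9 ≤ Δ) :
    LowBiasTree w Δ ((6 * h : ℕ) : ℤ) := by
  by_cases hsgn : (∀ i, 0 ≤ w i) ∨ (∀ i, w i ≤ 0)
  · apply lowBiasTree_of_sum_abs_le _ (by rcases hΔ with hΔ | hΔ <;> omega : 1 ≤ Δ)
    rw [sum_abs_eq_abs_sum_of_sameSign w hsgn]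
    exact hsum.trans (by push_cast; linarith)
  push Not at hsgn
  obtain ⟨⟨i₀, hi₀⟩, ⟨j₀, hj₀⟩⟩ := hsgn
  obtain ⟨x, y, hxy⟩ := h2
  have hw2 : ∀ k, w k = w i₀ ∨ w k = w j₀ := by
    intro k
    rcases hxy i₀ with h0 | h0 <;> rcases hxy j₀ with h1 | h1 <;> rcases hxy k with hk | hk
    all_goals
      first
      | exact Or.inl (hk.trans h0.symm)
      | exact Or.inr (hk.trans h1.symm)
      | (exfalso; rw [h0] at hi₀; rw [h1] at hj₀; linarith)
  have hah := hw i₀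
  have hbh := hw j₀
  rw [abs_of_neg hi₀] at hah
  rw [abs_of_pos hj₀] at hbh
  by_cases hcmp : w j₀ ≤ -w i₀
  · exact lowBiasTree_twoLetter_core w h hi₀ hj₀ hcmp hw2 hah hsum hΔ
  · have hneg := lowBiasTree_twoLetter_core (fun k => -w k) h (a := -w j₀) (b := -w i₀) (by linarith)
      (by linarith) (by push Not at hcmp; linarith)
      (fun k => by rcases hw2 k with hk | hk <;> [right; left] <;> simp [hk]) (by rw [neg_neg]; exact hbh)
      (by rw [sum_neg_distrib, abs_neg]; exact hsum) hΔ
    simpa using hneg.neg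

/-- **`ULB₂` verbatim on two-letter words**: the body of `UniversalLowBiasAt 2` with `B = 6`, `c₁ = 9`, for
every two-valued word (depth exactly `2·⌊log₂⌊log₂ d⌋⌋ + 9`). [cite: LimayeSrinivasanTavenas2022, Question 1] -/
theorem universalLowBiasAt_two_twoLetter (d : ℕ) (w : Fin d → ℤ) (h : ℕ)
    (h2 : ∃ x y : ℤ, ∀ i, w i = x ∨ w i = y) (hw : ∀ i, |w i| ≤ h) (hsum : |∑ i, w i| ≤ h) :
    LowBiasTree w (2 * Nat.log 2 (Nat.log 2 d) + 9) ((6 * h : ℕ) : ℤ) :=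
  lowBiasTree_twoLetter w h h2 hw hsum (Or.inr le_rfl)

/-- **Two-letter word families cannot witness `TreeBiasGrowthAt a` for any slope `a ≥ 2`.**  The statement
negated is `TreeBiasGrowthAt a` with the extra conjunct "the word is two-valued": an adversary certifying the
A-cell `HomImmHardAt 2 1` through the tree-bias door must use at least three distinct letter values.
[cite: LimayeSrinivasanTavenas2022, Prop. 17] -/
theorem not_twoLetter_treeBiasGrowthAt {a : ℕ} (ha : 2 ≤ a) :
    ¬ (∀ c C : ℕ, ∃ m₀ : ℕ, ∀ m : ℕ, m₀ ≤ m →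
        ∀ Δ : ℕ, Δ ≤ a * Nat.log 2 (Nat.log 2 (Nat.log 2 m)) + c + 1 →
          ∃ (sz : Fin (Nat.sqrt (Nat.log 2 m)) → ℕ) (pos : Fin (Nat.sqrt (Nat.log 2 m)) → Bool),
            (∀ i, 1 ≤ sz i) ∧ (∀ t ≤ Nat.sqrt (Nat.log 2 m), 2 ^ GenWord.overLen sz pos t ≤ m) ∧
            (∃ x y : ℤ, ∀ i, GenWord.wt sz pos i = x ∨ GenWord.wt sz pos i = y) ∧
            TreeBiasGe (GenWord.wt sz pos) Δ
              (2 * (C * (a * Nat.log 2 (Nat.log 2 (Nat.log 2 m)) + c + 2) * Nat.log 2 m))) := by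
  intro hG
  obtain ⟨m₀, hm₀⟩ := hG 9 6
  obtain ⟨m, hmm₀, hm2⟩ : ∃ m, m₀ ≤ m ∧ 2 ≤ m := ⟨max m₀ 2, le_max_left _ _, le_max_right _ _⟩
  have hL : 1 ≤ Nat.log 2 m := Nat.le_log_of_pow_le one_lt_two (by simpa using hm2)
  obtain ⟨sz, pos, _hsz, hfit, h2v, hTB⟩ := hm₀ m hmm₀ _ le_rfl
  have hwi : ∀ i, |GenWord.wt sz pos i| ≤ ((2 * Nat.log 2 m : ℕ) : ℤ) := fun i => abs_wt_le sz pos hfit i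
  have hws : |∑ i, GenWord.wt sz pos i| ≤ ((2 * Nat.log 2 m : ℕ) : ℤ) :=
    le_trans (abs_sum_wt_le sz pos hfit) (by push_cast; linarith)
  -- depth bookkeeping: 2·log₂log₂(2L) + 8 ≤ 2X + 10 ≤ aX + 10
  have hdepth : 2 * Nat.log 2 (Nat.log 2 (2 * Nat.log 2 m)) + 8 ≤
      a * Nat.log 2 (Nat.log 2 (Nat.log 2 m)) + 9 + 1 := by
    have h1 : Nat.log 2 (2 * Nat.log 2 m) = Nat.log 2 (Nat.log 2 m) + 1 := by
      rw [Nat.mul_comm]; exact Nat.log_mul_base one_lt_two (by omega)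
    have h2 : Nat.log 2 (Nat.log 2 (Nat.log 2 m) + 1) ≤ Nat.log 2 (Nat.log 2 (Nat.log 2 m)) + 1 :=
      (le_trans (Nat.log_mono_right (Nat.lt_pow_succ_log_self one_lt_two _)) (Nat.log_pow one_lt_two _).le)
    have h3 : 2 * Nat.log 2 (Nat.log 2 (Nat.log 2 m)) ≤ a * Nat.log 2 (Nat.log 2 (Nat.log 2 m)) :=
      Nat.mul_le_mul_right _ ha
    rw [h1]; omega
  have hT := lowBiasTree_twoLetter (GenWord.wt sz pos) (2 * Nat.log 2 m) h2v hwi hws (Or.inl hdepth)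
  refine not_treeBiasGe_of_lowBiasTree hT ?_ hTB
  have hnat : (a * Nat.log 2 (Nat.log 2 (Nat.log 2 m)) + 9 + 1) * (6 * (2 * Nat.log 2 m)) <
      2 * (6 * (a * Nat.log 2 (Nat.log 2 (Nat.log 2 m)) + 9 + 2) * Nat.log 2 m) := by
    have : (a * Nat.log 2 (Nat.log 2 (Nat.log 2 m)) + 9 + 1) * (6 * (2 * Nat.log 2 m)) + 12 * Nat.log 2 m =
        2 * (6 * (a * Nat.log 2 (Nat.log 2 (Nat.log 2 m)) + 9 + 2) * Nat.log 2 m) := by ring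
    omega
  exact_mod_cast hnat

end Summit.ValiantsHypothesis.ValiantsHypothesis.Theorems.DepthWindow.TreeBias
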